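import Mathlib
import HarnessLib

/-!
# HANDOFF — ASYMPTOTICS (A): the horizon inequalities of `dodger_witness_explicit` hold for every `b ≥ 60` (rh-explicit, track «HANDOFF», seat prove-2 gen10, ATTEMPT-19 §8 (P2)–(P3))

HONEST FRAMING. Nothing here bears on the truth of RH; this is elementary real analysis (Mathlib-only), the first part of the
parameter discharge (R-4) of the dodger wall ceiling. With `T₀(b) = 2πe^{1+2b}`, `s = s₁(T₀)` (`s₁(t) = 0.1038 log t + 0.2573 log log t
+ 9.3675`), `T* = T₀ − 4π(s+2)` and the lattice index `k′ = ⌊bT*/π⌋`, we prove, for every `b ≥ 60`: `9 ≤ s ≤ b`, `T₀ ≥ 12b²`,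
`T₀ ≤ (11/10)T*`, `s + 1 ≤ (14/2π)log(T₀/14)`, `T* − π/b ≤ πk′/b ≤ T*`, `3 ≤ πk′/b`, `2 ≤ k′`, `2 ≤ πk′/b − π(3s+5)/b`,
`1 ≤ k′ − 3s − 5` — the «horizon group» of hypotheses of `HandoffDodgerExplicit.dodger_witness_explicit` (the others, which involve
`y`, `N₁`, `q`, are part (B)). DEFINITIONS: `dodgerT₀`, `dodgerTstar`, `dodgerKprime`. No `sorry`, standard axioms.

References: this track (ATTEMPT-16 §6.1 (Q1)–(Q2), (Q9); ATTEMPT-19 §8).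
-/

set_option linter.dupNamespace false

noncomputable section

open Real

namespace Summit.RiemannHypothesis.RiemannHypothesis.Theorems.Handoff

/-- The HSW counting error `s₁(t)` (notation only). -/
local notation "s₁(" t ")" => (0.1038 * Real.log t + 0.2573 * Real.log (Real.log t) + 9.3675 : ℝ)

/-- `T₀(b) = 2πe^{1+2b}` — the height where the lattice `π/b` and the zeros have equal density. [this track, ATTEMPT-16 §1] -/
def dodgerT₀ (b : ℝ) : ℝ := 2 * π * Real.exp (1 + 2 * b)

/-- `T*(b) = T₀ − 4π(s₁(T₀) + 2)` — the undershot horizon. [this track, ATTEMPT-16 §1] -/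
def dodgerTstar (b : ℝ) : ℝ := dodgerT₀ b - 4 * π * (s₁(dodgerT₀ b) + 2)

/-- `k′(b) = ⌊bT*/π⌋` — the index of the last killed lattice point (`T′ = πk′/b`). [this track, ATTEMPT-16 §1; ATTEMPT-18 (D-2)] -/
def dodgerKprime (b : ℝ) : ℕ := ⌊b * dodgerTstar b / π⌋₊

/-! ## Basic sizes -/

/-- For `b ≥ 60`: `e ≤ T₀`, `12b² ≤ T₀`, `9 ≤ s₁(T₀) ≤ b`. [this track, ATTEMPT-19 §8] -/
theorem horizon_sizes {b : ℝ} (hb : 60 ≤ b) :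
    Real.exp 1 ≤ dodgerT₀ b ∧ 12 * b ^ 2 ≤ dodgerT₀ b ∧ 9 ≤ s₁(dodgerT₀ b) ∧ s₁(dodgerT₀ b) ≤ b := by
  have hπ3 : 3 < π := Real.pi_gt_three
  have hπ4 : π < 4 := by have := Real.pi_lt_d2; linarith
  set T₀ := dodgerT₀ b with hT₀
  have hlog : Real.log T₀ = Real.log (2 * π) + 1 + 2 * b := by
    rw [hT₀, dodgerT₀, Real.log_mul (by positivity) (Real.exp_pos _).ne', Real.log_exp]; ring
  have hl2π : Real.log (2 * π) ≤ 2 * π - 1 := Real.log_le_sub_one_of_pos (by positivity)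
  have hl2π0 : 0 ≤ Real.log (2 * π) := Real.log_nonneg (by linarith)
  have hexp : 2 * b ^ 2 ≤ Real.exp (1 + 2 * b) := by
    have h := Real.quadratic_le_exp_of_nonneg (show 0 ≤ 1 + 2 * b by linarith)
    nlinarith
  have hT₀ge : 12 * b ^ 2 ≤ T₀ := by
    rw [hT₀, dodgerT₀]; nlinarith [Real.exp_pos (1 + 2 * b), sq_nonneg b]
  have hT₀e : Real.exp 1 ≤ T₀ := by
    have := Real.exp_one_lt_d9; nlinarith
  have hT₀pos : 0 < T₀ := lt_of_lt_of_le (Real.exp_pos 1) hT₀e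
  have hlogT₀1 : 1 ≤ Real.log T₀ := by rw [hlog]; linarith
  have hlogT₀le : Real.log T₀ ≤ 2 * b + 8 := by rw [hlog]; linarith
  have hll0 : 0 ≤ Real.log (Real.log T₀) := Real.log_nonneg hlogT₀1
  have hll : Real.log (Real.log T₀) ≤ Real.log T₀ - 1 := Real.log_le_sub_one_of_pos (by linarith)
  refine ⟨hT₀e, hT₀ge, by nlinarith, by nlinarith⟩

/-- For `b ≥ 60`: the two clean-horizon side conditions `T₀ ≤ (11/10)T*` and `s + 1 ≤ (14/2π)log(T₀/14)`. [this track, ATTEMPT-16 (Q1a)(Q1b)] -/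
theorem horizon_side_conditions {b : ℝ} (hb : 60 ≤ b) :
    dodgerT₀ b ≤ 11 / 10 * (dodgerT₀ b - 4 * π * (s₁(dodgerT₀ b) + 2)) ∧
    s₁(dodgerT₀ b) + 1 ≤ 14 / (2 * π) * Real.log (dodgerT₀ b / 14) := by
  obtain ⟨hT₀e, hT₀ge, hs9, hsb⟩ := horizon_sizes hb
  have hπ3 : 3 < π := Real.pi_gt_three
  have hπ4 : π < 3.15 := Real.pi_lt_d2
  have hb2 : 3600 ≤ b ^ 2 := by nlinarith
  set T₀ := dodgerT₀ b with hT₀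
  set s := s₁(dodgerT₀ b) with hs
  have hT₀pos : 0 < T₀ := lt_of_lt_of_le (Real.exp_pos 1) hT₀e
  constructor
  · -- `44π(s+2) ≤ T₀`
    nlinarith
  · have hlog : Real.log (T₀ / 14) = Real.log (2 * π) + 1 + 2 * b - Real.log 14 := by
      rw [Real.log_div hT₀pos.ne' (by norm_num), hT₀, dodgerT₀, Real.log_mul (by positivity) (Real.exp_pos _).ne', Real.log_exp]
      ring
    have hl2π0 : 0 ≤ Real.log (2 * π) := Real.log_nonneg (by linarith)
    have hl14 : Real.log 14 ≤ 3 := by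
      rw [show (14 : ℝ) = 2 * 7 by norm_num, Real.log_mul (by norm_num) (by norm_num)]
      have h2 : Real.log 2 < 0.6931471808 := Real.log_two_lt_d9
      have h7 : Real.log 7 ≤ 2 := by
        have := Real.log_le_sub_one_of_pos (show (0:ℝ) < 7 / Real.exp 2 by positivity)
        rw [Real.log_div (by norm_num) (Real.exp_pos 2).ne', Real.log_exp] at this
        have he : 7 / Real.exp 2 ≤ 1 := by
          rw [div_le_one (Real.exp_pos 2)]
          have := Real.add_one_le_exp (2 : ℝ)
          nlinarith [Real.exp_pos (1:ℝ), Real.exp_one_gt_d9, show Real.exp 2 = Real.exp 1 * Real.exp 1 by rw [← Real.exp_add]; norm_num]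
        linarith
      linarith
    rw [hlog]
    have h14 : (2 : ℝ) ≤ 14 / (2 * π) := by rw [le_div_iff₀ (by positivity)]; linarith
    nlinarith

/-- For `b ≥ 60`: the lattice index `k′` satisfies `T* − π/b ≤ πk′/b ≤ T*`, `3 ≤ πk′/b`, `2 ≤ k′`,
`2 ≤ πk′/b − π(3s+5)/b`, `1 ≤ k′ − 3s − 5`, and `πk′/b ≤ T₀`. [this track, ATTEMPT-16 §1; ATTEMPT-19 §8] -/
theorem horizon_index_bounds {b : ℝ} (hb : 60 ≤ b) :
    π * (dodgerKprime b) / b ≤ dodgerTstar b ∧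
    dodgerTstar b - π / b ≤ π * (dodgerKprime b) / b ∧
    3 ≤ π * (dodgerKprime b) / b ∧ 2 ≤ dodgerKprime b ∧
    2 ≤ π * (dodgerKprime b) / b - π * (3 * s₁(dodgerT₀ b) + 5) / b ∧
    1 ≤ (dodgerKprime b : ℝ) - 3 * s₁(dodgerT₀ b) - 5 ∧
    π * (dodgerKprime b) / b ≤ dodgerT₀ b := by
  obtain ⟨hT₀e, hT₀ge, hs9, hsb⟩ := horizon_sizes hb
  have hπ3 : 3 < π := Real.pi_gt_three
  have hπ4 : π < 3.15 := Real.pi_lt_d2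
  have hπ := Real.pi_pos
  have hb0 : 0 < b := by linarith
  have hb2 : 3600 ≤ b ^ 2 := by nlinarith
  set T₀ := dodgerT₀ b with hT₀
  set s := s₁(dodgerT₀ b) with hs
  have hTs : dodgerTstar b = T₀ - 4 * π * (s + 2) := rfl
  set Ts := dodgerTstar b with hTsdef
  have hTs0 : 11 * b ^ 2 ≤ Ts := by rw [hTs]; nlinarith
  have hTspos : 0 < Ts := by nlinarith
  -- the floor
  have hx0 : 0 ≤ b * Ts / π := by positivity
  have hk1 : ((dodgerKprime b : ℕ) : ℝ) ≤ b * Ts / π := Nat.floor_le hx0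
  have hk2 : b * Ts / π - 1 ≤ ((dodgerKprime b : ℕ) : ℝ) := by
    have := Nat.lt_floor_add_one (b * Ts / π); rw [dodgerKprime]; linarith
  have hA : π * (dodgerKprime b) / b ≤ Ts := by
    rw [div_le_iff₀ hb0]
    have := mul_le_mul_of_nonneg_left hk1 hπ.le
    rw [mul_div_assoc', mul_comm π (b * Ts), mul_div_assoc, div_self hπ.ne', mul_one] at this
    linarith
  have hB : Ts - π / b ≤ π * (dodgerKprime b) / b := by
    rw [le_div_iff₀ hb0, sub_mul, div_mul_cancel₀ _ hb0.ne']
    have := mul_le_mul_of_nonneg_left hk2 hπ.le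
    rw [mul_sub, mul_one, mul_div_assoc', mul_comm π (b * Ts), mul_div_assoc, div_self hπ.ne', mul_one] at this
    linarith
  have hπb : π / b ≤ 1 := by rw [div_le_one hb0]; linarith
  have hπsb : π * (3 * s + 5) / b ≤ 4 * (3 * s + 5) / 60 := by
    rw [div_le_div_iff₀ hb0 (by norm_num)]
    nlinarith
  have hkr : 11 * b ^ 2 - 1 ≤ ((dodgerKprime b : ℕ) : ℝ) := by
    have : b * Ts / π ≥ Ts := by
      rw [ge_iff_le, le_div_iff₀ hπ]; nlinarith
    linarith
  have h3s : π * (3 * s + 5) / b ≤ (12 * b + 20) / 60 := hπsb.trans (by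
    apply div_le_div_of_nonneg_right _ (by norm_num); linarith)
  have hbb : 60 * b ≤ b ^ 2 := by nlinarith
  refine ⟨hA, hB, by linarith, ?_, by linarith [h3s, hB, hTs0, hbb, hπb], by nlinarith, ?_⟩
  · have : (2 : ℝ) ≤ ((dodgerKprime b : ℕ) : ℝ) := by nlinarith
    exact_mod_cast this
  · have : Ts ≤ T₀ := by rw [hTs]; nlinarith
    linarith

end Summit.RiemannHypothesis.RiemannHypothesis.Theorems.Handoff

end
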